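import Mathlib.Analysis.SpecialFunctions.Pow.Real
import Mathlib.Analysis.SpecialFunctions.Pow.Asymptotics
import Literature.Computability.AlgebraicComplexity.SimultaneousDoubleProduct
import Literature.Computability.AlgebraicComplexity.PrattTrapezoidValSDPP
import Literature.Computability.AlgebraicComplexity.GroupTheoreticMatMulProofs
import Literature.Computability.AlgebraicComplexity.GroupTheoreticMatMulThmBProofs
import Literature.Computability.AlgebraicComplexity.MatrixMultiplicationConjectureForms
import Literature.StrongHypotheses.MatrixMultiplication
import HarnessLib

/-!
# The `ω` bound from SDPP pairs in an abelian group; two families imply `ω = 2` (CKSU 2005, §4)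

Topic `Literature/Computability/AlgebraicComplexity`; companion of `SimultaneousDoubleProduct.lean`
(the simultaneous double product property `IsSDPP`, Cohn–Kleinberg–Szegedy–Umans 2005, Def. 4.1) and
of the registry entry `Literature.StrongHypotheses.MatrixMultiplication.CKSUTwoFamiliesConjecture`
(CKSU 2005, Conj. 4.7).  Everything here is PROVED; no named fact is introduced.

H. Cohn, R. Kleinberg, B. Szegedy, C. Umans, *Group-theoretic algorithms for matrix multiplication*,
FOCS 2005 = arXiv:math/0511460, §4 (p. 8 of the arXiv text, after Thm. 4.4 = "Theorem 23"):
"It is convenient to use two parameters `α` and `β` to describe pairs satisfying the simultaneous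
double product property: if there are `n` pairs, choose `α` and `β` so that `|Aᵢ||Bᵢ| ≥ n^α` for all
`i` and `|H| = n^β`.  If `H` is abelian Theorem 4.4 implies `ω ≤ (3β − 2)/α`."  And (before
Conj. 4.7 = "Conjecture 26"): "The most important case is when `H` is an abelian group.  There the
bound on `ω` is `ω ≤ (3β − 2)/α`, and Proposition 4.6 shows that the only way to achieve `ω = 2` is
`α = β = 2`.  We conjecture that that is possible".

## Results

* `IsSDPP.sum_rpow_omega_le_card_pow_three` — the CORE INEQUALITY: for an SDPP family
  `(Aᵢ, Bᵢ)_{i<n}` in a finite abelian group `H` and a corner-free index configuration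
  `j₁ j₂ j₃ : ι₀ → Fin n` (no `x, y, z` not all equal with `j₁ x = j₁ z`, `j₂ y = j₂ x`,
  `j₃ z = j₃ y`), `Σ_{x ∈ ι₀} (∏ₜ |A (jₜ x)| |B (jₜ x)|)^{ω/3} ≤ |H|³`.
* `alpha_mul_omega_add_two_le_of_sdpp_families` — the abelian `ω`-bound, asymptotic-family form:
  if for arbitrarily large `n` there are SDPP families of `n` pairs with `|Aᵢ||Bᵢ| ≥ n^α` and
  `|H| ≤ n^β`, then `α ω + 2 ≤ 3β`.
* `IsSDPP.alpha_mul_omega_add_two_le`, `IsSDPP.omega_le` — **CKSU 2005, §4, the abelian bound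
  `ω ≤ (3β − 2)/α`** for ONE SDPP family of `n ≥ 2` pairs (direct powers, CKSU Lemma 4.2 =
  `IsSDPP.piPow`, make `n` arbitrarily large without changing `α`, `β`).
* `omega_le_two_of_twoFamilies`, `omega_eq_two_of_twoFamilies`, `matrixMultiplication_of_twoFamilies`
  — **two families imply `ω = 2`**: the `ε`-reading of Conj. 4.7 (`α = 2 − ε`, `β = 2 + ε` for every
  `ε > 0`) gives `(2 − ε) ω ≤ 4 + 3ε` for every `ε`, hence `ω(ℂ) ≤ 2`, and `2 ≤ ω(ℂ)` is the flattening
  bound `omega_two_le`;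
  `cksuTwoFamiliesConjecture_imp_matrixMultiplication : CKSUTwoFamiliesConjecture → MatrixMultiplication`
  is the same with the registry's name for the hypothesis — the Literature-side content of the
  summit bridge `Summit.MatrixMultiplication.StrongHypotheses.CKSUTwoFamiliesConjectureImpliesMatrixMultiplication`
  (D-0034), whose discharge is then `fun h => MatrixMultiplication_iff.2 (omega_eq_two_of_twoFamilies h)`.
* `IsSDPP.card_mul_rpow_le_of_uniform`, `IsSDPP.sum_rpow_half_omega_le`, `IsSDPP.card_mul_rpow_le` —
  **CKSU 2005, Thm. 4.4 in the abelian case**, arithmetic-mean form `Σᵢ (|Aᵢ||Bᵢ|)^{ω/2} ≤ |H|^{3/2}`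
  for EVERY SDPP family in a finite abelian group (from the uniform case `M · L^{ω/2} ≤ |G|^{3/2}` by
  CKSU's own type-counting "geometric-to-arithmetic-mean" step on the direct power family), and its
  `α, β` product form `n (n^α)^{ω/2} ≤ (n^β)^{3/2}`.

## Proof, and where it deviates from the printed one

CKSU prove Thm. 4.4 (`Σᵢ (|Aᵢ||Bᵢ|)^{ω/2} ≤ (Σ_k d_k^ω)^{3/2}`, any finite `H`) through Thm. 4.3 (the
SDPP family realizes one large TPP triple in the wreath product `(H³)^{Δₙ} ⋊ Sym(Δₙ)`) and Thm. 1.8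
(the character-degree bound, tree: the NAMED FACT `CKSU2005_thm18`, not discharged).  For ABELIAN `H`
— the only case the `ω ≤ (3β − 2)/α` sentence and Conj. 4.7 are about — the same paper prints a
second road (§6.2 "Triangle-free sets", arXiv pp. 10–11: "The construction in Theorem 4.3 is also
easily interpreted in terms of the simultaneous triple product property … the triples `Â_v, B̂_v, Ĉ_v`
with `v` in a triangle-free subset of `Δₙ` satisfy the triple product property.  The critical question
is whether there is a triangle-free subset of `Δₙ` of size `|Δₙ|^{1−o(1)}`.  We give a simple
construction achieving this using Salem–Spencer sets", Lemma 6.1 = "Lemma 35"), which the tree has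
PROVED: the CKSU lift `Â_v = A_{v₁} × {0} × B_{v₃}`, `B̂_v = B_{v₁} × A_{v₂} × {0}`,
`Ĉ_v = {0} × B_{v₂} × A_{v₃}` over a corner-free configuration is an STPP family in `H³`
(`addSimultaneousTPP_of_sdpp`, `PrattTrapezoidValSDPP.lean`, as recalled in the proof of Pratt 2024
Thm. 4.7), Behrend gives corner-free configurations with `n^{2−η} ≤ 64 |ι₀|` for all large `n`
(`exists_cornerFree_indexMaps_card_ge`), and CKSU Thm. 5.5, abelian case
(`CohnKleinbergSzegedyUmans2005_5_5_abelian_holds`: `Σ (|Â||B̂||Ĉ|)^{ω/3} ≤ |H³|`, discharged via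
Schönhage's asymptotic sum inequality) replaces Thm. 1.8.  So we follow THAT road: the core inequality
gives `|ι₀| · n^{αω} ≤ n^{3β}`, i.e. `n^{2 − η + αω − 3β} ≤ 64` for all large `n`, whence
`αω + 2 − η ≤ 3β` for every `η ∈ (0, 1]`, and `η → 0`.  The passage from one family to arbitrarily
large `n` is CKSU's own ("by taking direct powers via Lemma 4.2, one can take `n` arbitrarily large
without changing `α` and `β`", proofs of Thm. 4.4 and Prop. 4.6; tree `IsSDPP.piPow`).
The arithmetic-mean statement of Thm. 4.4 (abelian) then follows as printed: direct powers, restriction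
to one type class `μ` (`M_μ` pairs of equal size `L_μ`), the uniform bound, and the count of types
(`≤ (N+1)^n`, CKSU's "Lemma geom→arith"), `N → ∞`.
-- TODO(general form): Thm. 4.4 for NON-abelian `H` (right-hand side `(Σ_k d_k^ω)^{3/2}`) needs
-- Thm. 1.8 (`CKSU2005_thm18`, an undischarged named fact) and the wreath-product character degrees;
-- no requester needs it and it is NOT asserted here.

The Summit-side files `Theorems/ThinBlockAlphaThinPackingsStubPackingToCThesis.lean`
(`ThinPackings.stub_packingToCThesis : CPackingConstruction → CThesis`) and the deciding theorem
`GroupTheoreticSTPP.closes : CThesis → MatrixMultiplication` assemble the same road inside route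
`GroupTheoreticSTPP`; this file is its Literature home (importable from `Literature/` and stated on
`IsSDPP` / `omega ℂ` without route items).

## References

* [CohnKleinbergSzegedyUmans2005] H. Cohn, R. Kleinberg, B. Szegedy, C. Umans, FOCS 2005, 379–388 =
  arXiv:math/0511460 (held: `paper:arxiv-math_0511460`, read pp. 7–11): Def. 4.1, Lemma 4.2, Thm. 4.3,
  Thm. 4.4 and the `α, β` paragraph after it, Prop. 4.6, Conj. 4.7, Def. 5.1, Thm. 5.5, §6.2 with
  Lemma 6.1 (arXiv environments 20–23, 25–27, 31, 35).
* [Pratt2024] K. Pratt, *On generalized corners and matrix multiplication*, ITCS 2024 =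
  arXiv:2309.03878, Def. 2.4, Conj. 2.5, proof of Thm. 4.7 (the SDPP → STPP lift recalled).
-/

noncomputable section

namespace Literature.Computability.AlgebraicComplexity

open Finset Literature.Combinatorics.Additive

/-! ### The core inequality: the CKSU lift of an SDPP family, fed to Thm. 5.5 (abelian) -/

section Core

variable {H : Type} [AddCommGroup H] [Fintype H] {n : ℕ} {A B : Fin n → Finset H}

/-- **Core inequality** (CKSU 2005, §6.2 with Thm. 5.5, abelian case): for an SDPP family
`(Aᵢ, Bᵢ)_{i<n}` in a finite abelian group `H` and a corner-free index configuration
`j₁ j₂ j₃ : ι₀ → Fin n`, the CKSU lift `(A (j₁x) × {0} × B (j₃x), B (j₁x) × A (j₂x) × {0},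
{0} × B (j₂x) × A (j₃x))_{x ∈ ι₀}` is an STPP family in `H × H × H` (`addSimultaneousTPP_of_sdpp`) of
volumes `∏ₜ |A (jₜ x)| |B (jₜ x)|`, so Thm. 5.5 (`CohnKleinbergSzegedyUmans2005_5_5_abelian_holds`) gives
`Σₓ (∏ₜ |A (jₜ x)| |B (jₜ x)|)^{ω/3} ≤ |H|³`.
[cite: CohnKleinbergSzegedyUmans2005, §6.2 (arXiv Lemma 35) and Thm. 5.5] -/
theorem IsSDPP.sum_rpow_omega_le_card_pow_three (h : IsSDPP A B) {ι₀ : Type} [Fintype ι₀]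
    (j₁ j₂ j₃ : ι₀ → Fin n)
    (hcf : ∀ x y z : ι₀, j₁ x = j₁ z → j₂ y = j₂ x → j₃ z = j₃ y → x = y ∧ y = z) :
    ∑ x, ((((A (j₁ x)).card * (B (j₁ x)).card) * ((A (j₂ x)).card * (B (j₂ x)).card) *
        ((A (j₃ x)).card * (B (j₃ x)).card) : ℕ) : ℝ) ^ (omega ℂ / 3) ≤
      (Fintype.card H : ℝ) ^ 3 := by
  classical
  -- the CKSU lift, an STPP family in `H × H × H` indexed by `ι₀`
  have hS : AddSimultaneousTPP (fun x => A (j₁ x) ×ˢ (({0} : Finset H) ×ˢ B (j₃ x)))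
      (fun x => B (j₁ x) ×ˢ (A (j₂ x) ×ˢ ({0} : Finset H)))
      (fun x => ({0} : Finset H) ×ˢ (B (j₂ x) ×ˢ A (j₃ x))) :=
    addSimultaneousTPP_of_sdpp h.1 h.2 j₁ j₂ j₃ hcf
  -- re-indexed by `Fin |ι₀|` and handed to Thm. 5.5 (abelian) in `H × H × H`
  set e : Fin (Fintype.card ι₀) ≃ ι₀ := (Fintype.equivFin ι₀).symm with he
  have hS' := (isSTPP_iff_addSimultaneousTPP _ _ _).2 (hS.comp e.injective)
  have h55 := CohnKleinbergSzegedyUmans2005_5_5_abelian_holds (H × H × H) (Fintype.card ι₀) _ _ _ hS'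
  simp only [Function.comp_apply, card_mul_card_mul_card_sdpp, Fintype.card_prod] at h55
  rw [Equiv.sum_comp e (fun x => ((((A (j₁ x)).card * (B (j₁ x)).card) *
      ((A (j₂ x)).card * (B (j₂ x)).card) * ((A (j₃ x)).card * (B (j₃ x)).card) : ℕ) : ℝ) ^
        (omega ℂ / 3))] at h55
  refine h55.trans (le_of_eq ?_)
  push_cast
  ring

end Core

/-! ### The abelian `ω`-bound `α ω + 2 ≤ 3 β` -/

section Bound

/-- Eventually `K < n ^ c` along the naturals, for `c > 0` (from `x ↦ x ^ c → ∞`). [folklore] -/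
theorem exists_nat_lt_rpow_of_pos {c : ℝ} (hc : 0 < c) (K : ℝ) :
    ∃ n₀ : ℕ, ∀ n : ℕ, n₀ ≤ n → K < (n : ℝ) ^ c := by
  have h := ((tendsto_rpow_atTop hc).comp tendsto_natCast_atTop_atTop).eventually_gt_atTop K
  obtain ⟨n₀, hn₀⟩ := Filter.eventually_atTop.1 h
  exact ⟨n₀, fun n hn => hn₀ n hn⟩

/-- **The abelian `ω`-bound, asymptotic-family form** (CKSU 2005, §4, "If `H` is abelian Theorem 4.4
implies `ω ≤ (3β − 2)/α`", along the §6.2 road): if for arbitrarily large `n` some finite abelian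
group `H` with `|H| ≤ n^β` carries an SDPP family of `n` pairs with `|Aᵢ||Bᵢ| ≥ n^α`, then
`α ω + 2 ≤ 3β`.  Proof: for `η ∈ (0,1]` and `n` large take a corner-free `j₁ j₂ j₃ : ι₀ → Fin n` with
`n^{2−η} ≤ 64 |ι₀|` (`exists_cornerFree_indexMaps_card_ge`, Behrend); the core inequality gives
`|ι₀| n^{αω} ≤ |H|³ ≤ n^{3β}`, so `n^{αω + 2 − η − 3β} ≤ 64` for arbitrarily large `n`, forcing
`αω + 2 − η ≤ 3β`; let `η → 0`.
[cite: CohnKleinbergSzegedyUmans2005, §4 (after Thm. 4.4) with §6.2 and Thm. 5.5] -/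
theorem alpha_mul_omega_add_two_le_of_sdpp_families {α β : ℝ}
    (hfam : ∀ n₀ : ℕ, ∃ n ≥ n₀, ∃ (H : Type) (_ : AddCommGroup H) (_ : Fintype H)
      (A B : Fin n → Finset H), IsSDPP A B ∧ (Fintype.card H : ℝ) ≤ (n : ℝ) ^ β ∧
        ∀ i : Fin n, (n : ℝ) ^ α ≤ (((A i).card * (B i).card : ℕ) : ℝ)) :
    α * omega ℂ + 2 ≤ 3 * β := by
  have hω0 : 0 ≤ omega ℂ := zero_le_two.trans (omega_two_le ℂ)
  -- Step 1: `αω + 2 − η ≤ 3β` for every `η ∈ (0, 1]`.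
  have step : ∀ η : ℝ, 0 < η → η ≤ 1 → α * omega ℂ + 2 - η ≤ 3 * β := by
    intro η hη hη1
    by_contra hlt
    rw [not_le] at hlt
    set c : ℝ := α * omega ℂ + 2 - η - 3 * β with hc
    have hc0 : 0 < c := by rw [hc]; linarith
    obtain ⟨n₁, hn₁⟩ := exists_cornerFree_indexMaps_card_ge η hη hη1
    obtain ⟨n₂, hn₂⟩ := exists_nat_lt_rpow_of_pos hc0 64
    obtain ⟨n, hn, H, _, _, A, B, hS, hH, hAB⟩ := hfam (max (max n₁ n₂) 2)
    have hnn₁ : n₁ ≤ n := le_trans (le_trans (le_max_left _ _) (le_max_left _ _)) hn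
    have hnn₂ : n₂ ≤ n := le_trans (le_trans (le_max_right _ _) (le_max_left _ _)) hn
    have hn2 : 2 ≤ n := le_trans (le_max_right _ _) hn
    have hnpos : (0 : ℝ) < n := by exact_mod_cast (lt_of_lt_of_le (by norm_num) hn2)
    obtain ⟨ι₀, _, _, j₁, j₂, j₃, hcard, hcf⟩ := hn₁ n hnn₁
    have hcore := hS.sum_rpow_omega_le_card_pow_three j₁ j₂ j₃ hcf
    -- each lifted block has volume `≥ n^{3α}`, so each term is `≥ n^{αω}`
    have hα0 : (0 : ℝ) ≤ (n : ℝ) ^ α := Real.rpow_nonneg hnpos.le _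
    have hterm : ∀ x : ι₀, (n : ℝ) ^ (α * omega ℂ) ≤
        ((((A (j₁ x)).card * (B (j₁ x)).card) * ((A (j₂ x)).card * (B (j₂ x)).card) *
          ((A (j₃ x)).card * (B (j₃ x)).card) : ℕ) : ℝ) ^ (omega ℂ / 3) := by
      intro x
      have hvol : (n : ℝ) ^ α * (n : ℝ) ^ α * (n : ℝ) ^ α ≤
          ((((A (j₁ x)).card * (B (j₁ x)).card) * ((A (j₂ x)).card * (B (j₂ x)).card) *
            ((A (j₃ x)).card * (B (j₃ x)).card) : ℕ) : ℝ) := by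
        have h1 := hAB (j₁ x)
        have h2 := hAB (j₂ x)
        have h3 := hAB (j₃ x)
        push_cast at h1 h2 h3 ⊢
        gcongr
      have hpow : (n : ℝ) ^ (α * omega ℂ) =
          ((n : ℝ) ^ α * (n : ℝ) ^ α * (n : ℝ) ^ α) ^ (omega ℂ / 3) := by
        rw [← Real.rpow_add hnpos, ← Real.rpow_add hnpos, ← Real.rpow_mul hnpos.le]
        ring_nf
      rw [hpow]
      exact Real.rpow_le_rpow (by positivity) hvol (by positivity)
    -- summing: `|ι₀| n^{αω} ≤ |H|³ ≤ n^{3β}`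
    have hsum : (Fintype.card ι₀ : ℝ) * (n : ℝ) ^ (α * omega ℂ) ≤ (n : ℝ) ^ (3 * β) := by
      calc (Fintype.card ι₀ : ℝ) * (n : ℝ) ^ (α * omega ℂ)
          = ∑ _x : ι₀, (n : ℝ) ^ (α * omega ℂ) := by
            rw [sum_const, card_univ, nsmul_eq_mul]
        _ ≤ ∑ x : ι₀, ((((A (j₁ x)).card * (B (j₁ x)).card) * ((A (j₂ x)).card * (B (j₂ x)).card) *
              ((A (j₃ x)).card * (B (j₃ x)).card) : ℕ) : ℝ) ^ (omega ℂ / 3) :=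
            sum_le_sum fun x _ => hterm x
        _ ≤ (Fintype.card H : ℝ) ^ 3 := hcore
        _ ≤ ((n : ℝ) ^ β) ^ 3 := by gcongr
        _ = (n : ℝ) ^ (3 * β) := by
            rw [← Real.rpow_natCast, ← Real.rpow_mul hnpos.le]
            norm_num
            ring_nf
    -- with `n^{2-η} ≤ 64 |ι₀|`: `n^c ≤ 64`, contradicting `64 < n^c`
    have hc_le : (n : ℝ) ^ c ≤ 64 := by
      have h1 : (n : ℝ) ^ (2 - η) * (n : ℝ) ^ (α * omega ℂ) ≤ 64 * (n : ℝ) ^ (3 * β) :=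
        calc (n : ℝ) ^ (2 - η) * (n : ℝ) ^ (α * omega ℂ)
            ≤ (64 * Fintype.card ι₀) * (n : ℝ) ^ (α * omega ℂ) :=
              mul_le_mul_of_nonneg_right hcard (Real.rpow_nonneg hnpos.le _)
          _ = 64 * ((Fintype.card ι₀ : ℝ) * (n : ℝ) ^ (α * omega ℂ)) := by ring
          _ ≤ 64 * (n : ℝ) ^ (3 * β) := by gcongr
      have h2 : (n : ℝ) ^ c = (n : ℝ) ^ (2 - η) * (n : ℝ) ^ (α * omega ℂ) / (n : ℝ) ^ (3 * β) := by
        rw [← Real.rpow_add hnpos, ← Real.rpow_sub hnpos, hc]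
        ring_nf
      rw [h2, div_le_iff₀ (Real.rpow_pos_of_pos hnpos _)]
      exact h1
    exact absurd (hn₂ n hnn₂) (not_lt.2 hc_le)
  -- Step 2: `η → 0`.
  refine le_of_forall_pos_le_add fun η hη => ?_
  by_cases hη1 : η ≤ 1
  · linarith [step η hη hη1]
  · linarith [step 1 one_pos le_rfl, (not_le.1 hη1).le]

end Bound

/-! ### One SDPP family: CKSU's `ω ≤ (3β − 2)/α` via direct powers -/

section OneFamily

variable {H : Type} [AddCommGroup H] [Fintype H] {n : ℕ} {A B : Fin n → Finset H}

/-- **CKSU 2005, §4, abelian `ω`-bound for one SDPP family** (product form `α ω + 2 ≤ 3β`): if a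
finite abelian group `H` with `|H| ≤ n^β` carries an SDPP family of `n ≥ 2` pairs with
`|Aᵢ||Bᵢ| ≥ n^α`, then `α ω(ℂ) + 2 ≤ 3β`.  As in the proofs of CKSU Thm. 4.4 / Prop. 4.6, the
`N`-fold direct powers of the family (Lemma 4.2 iterated, `IsSDPP.piPow`: `n^N` pairs in `H^N` with
`|A'||B'| ≥ (n^N)^α`, `|H^N| ≤ (n^N)^β`) make `n` arbitrarily large without changing `α` and `β`,
and `alpha_mul_omega_add_two_le_of_sdpp_families` applies.
[cite: CohnKleinbergSzegedyUmans2005, §4 (after Thm. 4.4) with Lemma 4.2] -/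
theorem IsSDPP.alpha_mul_omega_add_two_le (hS : IsSDPP A B) (hn : 2 ≤ n) {α β : ℝ}
    (hα : ∀ i : Fin n, (n : ℝ) ^ α ≤ (((A i).card * (B i).card : ℕ) : ℝ))
    (hβ : (Fintype.card H : ℝ) ≤ (n : ℝ) ^ β) :
    α * omega ℂ + 2 ≤ 3 * β := by
  classical
  have hnpos : (0 : ℝ) < n := by exact_mod_cast (lt_of_lt_of_le (by norm_num) hn)
  refine alpha_mul_omega_add_two_le_of_sdpp_families fun N => ?_
  refine ⟨n ^ N, (Nat.lt_pow_self (lt_of_lt_of_le (by norm_num) hn)).le, (Fin N → H), inferInstance,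
    inferInstance,
    fun w => Fintype.piFinset fun c : Fin N => A (finFunctionFinEquiv.symm w c),
    fun w => Fintype.piFinset fun c : Fin N => B (finFunctionFinEquiv.symm w c),
    hS.piPow N, ?_, fun w => ?_⟩
  · -- `|H^N| = |H|^N ≤ (n^β)^N = (n^N)^β`
    rw [Fintype.card_fun, Fintype.card_fin]
    push_cast
    calc (Fintype.card H : ℝ) ^ N ≤ ((n : ℝ) ^ β) ^ N := by gcongr
      _ = ((n : ℝ) ^ N) ^ β := by
          rw [← Real.rpow_natCast, ← Real.rpow_mul hnpos.le, ← Real.rpow_natCast,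
            ← Real.rpow_mul hnpos.le, mul_comm]
  · -- `|∏ A (w c)| |∏ B (w c)| = ∏ |A (w c)||B (w c)| ≥ (n^α)^N = (n^N)^α`
    rw [Fintype.card_piFinset, Fintype.card_piFinset, ← prod_mul_distrib]
    push_cast
    calc (((n : ℝ)) ^ N) ^ α = ∏ _c : Fin N, (n : ℝ) ^ α := by
          rw [prod_const, card_univ, Fintype.card_fin, ← Real.rpow_natCast,
            ← Real.rpow_mul hnpos.le, mul_comm, Real.rpow_mul hnpos.le, Real.rpow_natCast]
      _ ≤ ∏ c : Fin N, (((A (finFunctionFinEquiv.symm w c)).card : ℝ) *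
            ((B (finFunctionFinEquiv.symm w c)).card : ℝ)) :=
          prod_le_prod (fun _ _ => Real.rpow_nonneg hnpos.le _) fun c _ => by
            have := hα (finFunctionFinEquiv.symm w c)
            push_cast at this
            exact this

/-- **CKSU 2005, §4: "If `H` is abelian Theorem 4.4 implies `ω ≤ (3β − 2)/α`"** (`|Aᵢ||Bᵢ| ≥ n^α`
for all `i`, `|H| ≤ n^β`, `n ≥ 2` pairs, `α > 0`), proved along the paper's §6.2 road
(`IsSDPP.alpha_mul_omega_add_two_le`). [cite: CohnKleinbergSzegedyUmans2005, §4 (after Thm. 4.4)] -/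
theorem IsSDPP.omega_le (hS : IsSDPP A B) (hn : 2 ≤ n) {α β : ℝ} (hα0 : 0 < α)
    (hα : ∀ i : Fin n, (n : ℝ) ^ α ≤ (((A i).card * (B i).card : ℕ) : ℝ))
    (hβ : (Fintype.card H : ℝ) ≤ (n : ℝ) ^ β) :
    omega ℂ ≤ (3 * β - 2) / α := by
  rw [le_div_iff₀ hα0]
  linarith [hS.alpha_mul_omega_add_two_le hn hα hβ]

end OneFamily

/-! ### Two families imply `ω = 2` -/

section TwoFamilies

/-- **Two families imply `ω(ℂ) ≤ 2`** (CKSU 2005, §4: with `α = 2 − ε`, `β = 2 + ε` the abelian bound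
reads `(2 − ε) ω + 2 ≤ 3 (2 + ε)`, i.e. `ω ≤ (4 + 3ε)/(2 − ε)`, for every `ε > 0`; let `ε → 0`).  The
hypothesis is verbatim the `ε`-reading of Conj. 4.7 registered as
`Literature.StrongHypotheses.MatrixMultiplication.CKSUTwoFamiliesConjecture`.
[cite: CohnKleinbergSzegedyUmans2005, Thm. 4.4 and Conj. 4.7 (arXiv Theorem 23, Conjecture 26)] -/
theorem omega_le_two_of_twoFamilies
    (h : ∀ ε : ℝ, 0 < ε → ∀ n₀ : ℕ, ∃ n ≥ n₀,
      ∃ (H : Type) (_ : AddCommGroup H) (_ : Fintype H) (A B : Fin n → Finset H),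
        IsSDPP A B ∧ (Fintype.card H : ℝ) ≤ (n : ℝ) ^ (2 + ε) ∧
          ∀ i : Fin n, (n : ℝ) ^ (2 - ε) ≤ (((A i).card * (B i).card : ℕ) : ℝ)) :
    omega ℂ ≤ 2 := by
  have hb : ∀ ε : ℝ, 0 < ε → (2 - ε) * omega ℂ + 2 ≤ 3 * (2 + ε) := fun ε hε =>
    alpha_mul_omega_add_two_le_of_sdpp_families (h ε hε)
  refine le_of_forall_pos_lt_add fun δ hδ => ?_
  set ε : ℝ := min (1 / 2) (δ / 10) with hε
  have hε0 : 0 < ε := by rw [hε]; exact lt_min (by norm_num) (by positivity)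
  have hε1 : ε ≤ 1 / 2 := min_le_left _ _
  have hεδ : ε ≤ δ / 10 := min_le_right _ _
  have h1 := hb ε hε0
  by_contra hge
  rw [not_lt] at hge
  have h2 : (2 - ε) * (2 + δ) ≤ (2 - ε) * omega ℂ := mul_le_mul_of_nonneg_left hge (by linarith)
  have h3 : (2 - ε) * (2 + δ) = 4 + 2 * δ - 2 * ε - ε * δ := by ring
  have h4 : ε * δ ≤ 1 / 2 * δ := mul_le_mul_of_nonneg_right hε1 hδ.le
  linarith

/-- **Two families imply `ω(ℂ) = 2`** (CKSU 2005, §4: Conj. 4.7 ⟹ `ω = 2`), with the flattening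
lower bound `2 ≤ ω` (`omega_two_le`).
[cite: CohnKleinbergSzegedyUmans2005, Thm. 4.4 and Conj. 4.7 (arXiv Theorem 23, Conjecture 26)] -/
theorem omega_eq_two_of_twoFamilies
    (h : ∀ ε : ℝ, 0 < ε → ∀ n₀ : ℕ, ∃ n ≥ n₀,
      ∃ (H : Type) (_ : AddCommGroup H) (_ : Fintype H) (A B : Fin n → Finset H),
        IsSDPP A B ∧ (Fintype.card H : ℝ) ≤ (n : ℝ) ^ (2 + ε) ∧
          ∀ i : Fin n, (n : ℝ) ^ (2 - ε) ≤ (((A i).card * (B i).card : ℕ) : ℝ)) :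
    omega ℂ = 2 :=
  le_antisymm (omega_le_two_of_twoFamilies h) (omega_two_le ℂ)

/-- **Two families imply `MatrixMultiplication`** (`:= omega ℂ = 2`).
[cite: CohnKleinbergSzegedyUmans2005, Thm. 4.4 and Conj. 4.7 (arXiv Theorem 23, Conjecture 26)] -/
theorem matrixMultiplication_of_twoFamilies
    (h : ∀ ε : ℝ, 0 < ε → ∀ n₀ : ℕ, ∃ n ≥ n₀,
      ∃ (H : Type) (_ : AddCommGroup H) (_ : Fintype H) (A B : Fin n → Finset H),
        IsSDPP A B ∧ (Fintype.card H : ℝ) ≤ (n : ℝ) ^ (2 + ε) ∧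
          ∀ i : Fin n, (n : ℝ) ^ (2 - ε) ≤ (((A i).card * (B i).card : ℕ) : ℝ)) :
    MatrixMultiplication :=
  omega_eq_two_of_twoFamilies h

/-- **CKSU two-families conjecture ⟹ `ω(ℂ) = 2`**, with the registry's name for the hypothesis
(`Literature.StrongHypotheses.MatrixMultiplication.CKSUTwoFamiliesConjecture`, CKSU Conj. 4.7 =
arXiv "Conjecture 26", unfolds to the hypothesis of `omega_eq_two_of_twoFamilies`): the Literature-side
content of the printed summit bridge
`Summit.MatrixMultiplication.StrongHypotheses.CKSUTwoFamiliesConjectureImpliesMatrixMultiplication` (D-0034).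
[cite: CohnKleinbergSzegedyUmans2005, Thm. 4.4 and Conj. 4.7 (arXiv Theorem 23, Conjecture 26)] -/
theorem cksuTwoFamiliesConjecture_imp_matrixMultiplication :
    Literature.StrongHypotheses.MatrixMultiplication.CKSUTwoFamiliesConjecture → MatrixMultiplication :=
  fun h => matrixMultiplication_of_twoFamilies h

end TwoFamilies

/-! ### CKSU Thm. 4.4, abelian case: the arithmetic-mean form `Σᵢ (|Aᵢ||Bᵢ|)^{ω/2} ≤ |H|^{3/2}` -/

section Thm44

/-- **Uniform SDPP families** (the inequality of the proof of CKSU Thm. 4.4 after "taking `2P`-th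
roots and letting `N → ∞`", abelian case, for a family whose `M` pairs all have `|Aᵢ||Bᵢ| = L`):
`M · L^{ω/2} ≤ |G|^{3/2}`.  For `M ≥ 2`, `L ≥ 1` this is `IsSDPP.alpha_mul_omega_add_two_le` with
`α = log_M L`, `β = log_M |G|` (`αω + 2 ≤ 3β` reads `ω log L + 2 log M ≤ 3 log |G|`); for `M = 1` it is
`L ≤ |G|` (the double product property, `IsSDPP.card_mul_card_le`) with `ω ≤ 3` (`omega_le_three'`).
[cite: CohnKleinbergSzegedyUmans2005, Thm. 4.4 (proof)] -/
theorem IsSDPP.card_mul_rpow_le_of_uniform {G : Type} [AddCommGroup G] [Fintype G] {M : ℕ}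
    {A B : Fin M → Finset G} (hS : IsSDPP A B) {L : ℕ} (hL : ∀ i, (A i).card * (B i).card = L) :
    (M : ℝ) * (L : ℝ) ^ (omega ℂ / 2) ≤ (Fintype.card G : ℝ) ^ ((3 : ℝ) / 2) := by
  have hω2 : 2 ≤ omega ℂ := omega_two_le ℂ
  have hω3 : omega ℂ ≤ 3 := omega_le_three' (K := ℂ)
  have hGpos : (0 : ℝ) < Fintype.card G := by exact_mod_cast Fintype.card_pos
  have hG1 : (1 : ℝ) ≤ Fintype.card G := by exact_mod_cast Fintype.card_pos
  rcases Nat.lt_or_ge M 2 with hM | hM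
  · interval_cases M
    · rw [Nat.cast_zero, zero_mul]
      positivity
    · have hL0 : (L : ℝ) ≤ Fintype.card G := by
        have h := hS.card_mul_card_le 0
        rw [hL 0] at h
        exact_mod_cast h
      calc ((1 : ℕ) : ℝ) * (L : ℝ) ^ (omega ℂ / 2) = (L : ℝ) ^ (omega ℂ / 2) := by simp
        _ ≤ (Fintype.card G : ℝ) ^ (omega ℂ / 2) :=
            Real.rpow_le_rpow (Nat.cast_nonneg _) hL0 (by positivity)
        _ ≤ (Fintype.card G : ℝ) ^ ((3 : ℝ) / 2) :=
            Real.rpow_le_rpow_of_exponent_le hG1 (by linarith)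
  · rcases Nat.eq_zero_or_pos L with hL0 | hLpos
    · subst hL0
      rw [Nat.cast_zero, Real.zero_rpow (by positivity : omega ℂ / 2 ≠ 0), mul_zero]
      positivity
    · have hMpos : (0 : ℝ) < M := by exact_mod_cast (lt_of_lt_of_le (by norm_num) hM)
      have hM1 : (1 : ℝ) < M := by exact_mod_cast (lt_of_lt_of_le (by norm_num) hM)
      have hLposR : (0 : ℝ) < L := by exact_mod_cast hLpos
      set α : ℝ := Real.logb M L with hα
      set β : ℝ := Real.logb M (Fintype.card G) with hβ
      have hαeq : (M : ℝ) ^ α = L := Real.rpow_logb hMpos hM1.ne' hLposR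
      have hβeq : (M : ℝ) ^ β = Fintype.card G := Real.rpow_logb hMpos hM1.ne' hGpos
      have h := hS.alpha_mul_omega_add_two_le hM (α := α) (β := β)
        (fun i => by rw [hαeq]; exact_mod_cast (hL i).ge) (by rw [hβeq])
      have hlogM : 0 < Real.log M := Real.log_pos hM1
      have hαlog : α * Real.log M = Real.log L := by
        rw [hα, Real.logb, div_mul_cancel₀ _ hlogM.ne']
      have hβlog : β * Real.log M = Real.log (Fintype.card G) := by
        rw [hβ, Real.logb, div_mul_cancel₀ _ hlogM.ne']
      have e1 : (α * omega ℂ + 2) * Real.log M = omega ℂ * Real.log L + 2 * Real.log M := by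
        rw [← hαlog]; ring
      have e2 : 3 * β * Real.log M = 3 * Real.log (Fintype.card G) := by
        rw [← hβlog]; ring
      have h3 : (α * omega ℂ + 2) * Real.log M ≤ 3 * β * Real.log M :=
        mul_le_mul_of_nonneg_right h hlogM.le
      rw [e1, e2] at h3
      rw [← Real.log_le_log_iff (by positivity) (by positivity), Real.log_mul hMpos.ne'
        (Real.rpow_pos_of_pos hLposR _).ne', Real.log_rpow hLposR, Real.log_rpow hGpos]
      linarith

/-- **Cohn–Kleinberg–Szegedy–Umans 2005, Thm. 4.4, abelian case** ("If `H` is a finite group with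
character degrees `{d_k}`, and `n` pairs of subsets `Aᵢ, Bᵢ ⊆ H` satisfy the simultaneous double
product property, then `Σᵢ (|Aᵢ||Bᵢ|)^{ω/2} ≤ (Σ_k d_k^ω)^{3/2}`"; for abelian `H`, `Σ_k d_k^ω = |H|`):
`Σᵢ (|Aᵢ||Bᵢ|)^{ω(ℂ)/2} ≤ |H|^{3/2}`.  Proof with the architecture of the printed one, the wreath-product
step replaced as explained in the module docstring: pass to the `N`-fold direct power family (Lemma 4.2,
`IsSDPP.piPow`; `n^N` pairs indexed by words `w`, sizes `∏_c |A_{w_c}||B_{w_c}|`), sort the words by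
type `μ` (`μᵢ = #{c : w_c = i}`; within a type all `M_μ` pairs have the same size `L_μ = ∏ᵢ (|Aᵢ||Bᵢ|)^{μᵢ}`
and form an SDPP sub-family, `IsSDPP.reindex`), bound each type by the uniform inequality
`M_μ L_μ^{ω/2} ≤ |H^N|^{3/2}` (`IsSDPP.card_mul_rpow_le_of_uniform`), and count types (`≤ (N+1)^n`):
`(Σᵢ (|Aᵢ||Bᵢ|)^{ω/2})^N = Σ_w (∏_c |A_{w_c}||B_{w_c}|)^{ω/2} ≤ (N+1)^n (|H|^{3/2})^N` for every `N`
(CKSU's "Lemma geom→arith"), whence the claim by `N → ∞` (`Combinatorics.le_of_pow_le_poly_mul_pow`).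
-- TODO(general form): non-abelian `H` (right-hand side `(Σ_k d_k^ω)^{3/2}`) needs Thm. 1.8
-- (`CKSU2005_thm18`, a named fact) and wreath-product character degrees; not asserted here.
[cite: CohnKleinbergSzegedyUmans2005, Thm. 4.4 (arXiv Theorem 23)] -/
theorem IsSDPP.sum_rpow_half_omega_le {H : Type} [AddCommGroup H] [Fintype H] {n : ℕ}
    {A B : Fin n → Finset H} (hS : IsSDPP A B) :
    ∑ i, (((A i).card * (B i).card : ℕ) : ℝ) ^ (omega ℂ / 2) ≤
      (Fintype.card H : ℝ) ^ ((3 : ℝ) / 2) := by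
  classical
  have hHpos : (0 : ℝ) < Fintype.card H := by exact_mod_cast Fintype.card_pos
  have hypos : (0 : ℝ) < (Fintype.card H : ℝ) ^ ((3 : ℝ) / 2) := Real.rpow_pos_of_pos hHpos _
  refine Combinatorics.le_of_pow_le_poly_mul_pow (c := 1) (d := n) hypos fun N _hN => ?_
  -- sizes and types
  set sz : Fin n → ℕ := fun i => (A i).card * (B i).card with hsz
  let T : (Fin N → Fin n) → (Fin n → ℕ) := fun w i => (univ.filter fun c => w c = i).card
  let Lμ : (Fin n → ℕ) → ℕ := fun μ => ∏ i, sz i ^ μ i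
  have hprodT : ∀ w : Fin N → Fin n, ∏ c, sz (w c) = Lμ (T w) := by
    intro w
    rw [← Finset.prod_fiberwise univ w (fun c => sz (w c))]
    refine prod_congr rfl fun j _ => ?_
    rw [prod_congr rfl (fun c hc => by rw [(mem_filter.1 hc).2]), prod_const]
  -- (1) expand the `N`-th power of the sum over words
  have hexp : (∑ i, ((sz i : ℕ) : ℝ) ^ (omega ℂ / 2)) ^ N =
      ∑ w : Fin N → Fin n, ((Lμ (T w) : ℕ) : ℝ) ^ (omega ℂ / 2) := by
    rw [Finset.sum_pow', Fintype.piFinset_univ]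
    refine sum_congr rfl fun w _ => ?_
    rw [Real.finsetProd_rpow _ _ (fun c _ => by positivity), ← hprodT w]
    push_cast
    rfl
  -- (2) the direct power family (Lemma 4.2), indexed by `Fin (n ^ N)`
  set A' : Fin (n ^ N) → Finset (Fin N → H) :=
    fun w => Fintype.piFinset fun c : Fin N => A (finFunctionFinEquiv.symm w c) with hA'
  set B' : Fin (n ^ N) → Finset (Fin N → H) :=
    fun w => Fintype.piFinset fun c : Fin N => B (finFunctionFinEquiv.symm w c) with hB'
  have hS' : IsSDPP A' B' := hS.piPow N
  have hsize : ∀ w : Fin N → Fin n,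
      (A' (finFunctionFinEquiv w)).card * (B' (finFunctionFinEquiv w)).card = Lμ (T w) := by
    intro w
    rw [← hprodT w, hA', hB']
    simp only [Fintype.card_piFinset, Equiv.symm_apply_apply, ← prod_mul_distrib, hsz]
  -- (3) each type class is a uniform SDPP sub-family: `M_μ · L_μ^{ω/2} ≤ |H^N|^{3/2}`
  have hfiber : ∀ μ : Fin n → ℕ,
      ((univ.filter fun w : Fin N → Fin n => T w = μ).card : ℝ) * ((Lμ μ : ℕ) : ℝ) ^ (omega ℂ / 2) ≤
        (Fintype.card (Fin N → H) : ℝ) ^ ((3 : ℝ) / 2) := by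
    intro μ
    set F := univ.filter fun w : Fin N → Fin n => T w = μ with hF
    set e : Fin F.card ≃ {w // w ∈ F} := F.equivFin.symm with he
    set ι : Fin F.card → Fin (n ^ N) := fun k => finFunctionFinEquiv (e k).1 with hι
    have hιinj : Function.Injective ι := fun k k' hkk' =>
      e.injective (Subtype.ext (finFunctionFinEquiv.injective hkk'))
    have hsub : IsSDPP (A' ∘ ι) (B' ∘ ι) := hS'.reindex ι hιinj
    have hunif : ∀ k : Fin F.card, ((A' ∘ ι) k).card * ((B' ∘ ι) k).card = Lμ μ := by
      intro k
      have hk : T (e k).1 = μ := (mem_filter.1 (e k).2).2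
      rw [Function.comp_apply, Function.comp_apply, hι]
      simp only
      rw [hsize, hk]
    exact hsub.card_mul_rpow_le_of_uniform hunif
  -- (4) group the words by type and count the types
  have hcardpow : (Fintype.card (Fin N → H) : ℝ) ^ ((3 : ℝ) / 2) =
      ((Fintype.card H : ℝ) ^ ((3 : ℝ) / 2)) ^ N := by
    rw [Fintype.card_fun, Fintype.card_fin]
    push_cast
    rw [← Real.rpow_natCast, ← Real.rpow_mul hHpos.le, ← Real.rpow_natCast,
      ← Real.rpow_mul hHpos.le, mul_comm]
  have htypes : ((univ : Finset (Fin N → Fin n)).image T).card ≤ (N + 1) ^ n := by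
    have hsubset : (univ : Finset (Fin N → Fin n)).image T ⊆
        Fintype.piFinset fun _ : Fin n => range (N + 1) := by
      intro μ hμ
      rw [mem_image] at hμ
      obtain ⟨w, -, rfl⟩ := hμ
      rw [Fintype.mem_piFinset]
      intro i
      rw [mem_range, Nat.lt_succ_iff]
      exact (card_filter_le _ _).trans (by rw [card_univ, Fintype.card_fin])
    refine (card_le_card hsubset).trans ?_
    rw [Fintype.card_piFinset, prod_const, card_range, card_univ, Fintype.card_fin]
  calc (∑ i, ((sz i : ℕ) : ℝ) ^ (omega ℂ / 2)) ^ N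
      = ∑ w : Fin N → Fin n, ((Lμ (T w) : ℕ) : ℝ) ^ (omega ℂ / 2) := hexp
    _ = ∑ μ ∈ (univ : Finset (Fin N → Fin n)).image T,
          (univ.filter fun w : Fin N → Fin n => T w = μ).card •
            ((Lμ μ : ℕ) : ℝ) ^ (omega ℂ / 2) :=
        Finset.sum_comp (fun μ => ((Lμ μ : ℕ) : ℝ) ^ (omega ℂ / 2)) T
    _ ≤ ∑ _μ ∈ (univ : Finset (Fin N → Fin n)).image T,
          ((Fintype.card H : ℝ) ^ ((3 : ℝ) / 2)) ^ N := by
        refine sum_le_sum fun μ _ => ?_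
        rw [nsmul_eq_mul, ← hcardpow]
        exact hfiber μ
    _ = (((univ : Finset (Fin N → Fin n)).image T).card : ℝ) *
          ((Fintype.card H : ℝ) ^ ((3 : ℝ) / 2)) ^ N := by
        rw [sum_const, nsmul_eq_mul]
    _ ≤ (((N + 1) ^ n : ℕ) : ℝ) * ((Fintype.card H : ℝ) ^ ((3 : ℝ) / 2)) ^ N := by
        gcongr
    _ = 1 * ((N : ℝ) + 1) ^ n * ((Fintype.card H : ℝ) ^ ((3 : ℝ) / 2)) ^ N := by
        push_cast
        ring

/-- The abelian Thm. 4.4 in CKSU's `α, β` parametrisation recovers `ω ≤ (3β − 2)/α` at once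
(`n · n^{αω/2} ≤ Σᵢ (|Aᵢ||Bᵢ|)^{ω/2} ≤ |H|^{3/2} ≤ n^{3β/2}`); recorded as the product form
`n · (n^α)^{ω/2} ≤ (n^β)^{3/2}` for families with `|Aᵢ||Bᵢ| ≥ n^α`, `|H| ≤ n^β`.
[cite: CohnKleinbergSzegedyUmans2005, Thm. 4.4 and §4 (after Thm. 4.4)] -/
theorem IsSDPP.card_mul_rpow_le {H : Type} [AddCommGroup H] [Fintype H] {n : ℕ}
    {A B : Fin n → Finset H} (hS : IsSDPP A B) {α β : ℝ}
    (hα : ∀ i : Fin n, (n : ℝ) ^ α ≤ (((A i).card * (B i).card : ℕ) : ℝ))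
    (hβ : (Fintype.card H : ℝ) ≤ (n : ℝ) ^ β) :
    (n : ℝ) * ((n : ℝ) ^ α) ^ (omega ℂ / 2) ≤ ((n : ℝ) ^ β) ^ ((3 : ℝ) / 2) := by
  have hω0 : 0 ≤ omega ℂ / 2 := by linarith [omega_two_le ℂ]
  calc (n : ℝ) * ((n : ℝ) ^ α) ^ (omega ℂ / 2)
      = ∑ _i : Fin n, ((n : ℝ) ^ α) ^ (omega ℂ / 2) := by
        rw [sum_const, card_univ, Fintype.card_fin, nsmul_eq_mul]
    _ ≤ ∑ i, (((A i).card * (B i).card : ℕ) : ℝ) ^ (omega ℂ / 2) :=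
        sum_le_sum fun i _ => Real.rpow_le_rpow (Real.rpow_nonneg (Nat.cast_nonneg _) _) (hα i) hω0
    _ ≤ (Fintype.card H : ℝ) ^ ((3 : ℝ) / 2) := hS.sum_rpow_half_omega_le
    _ ≤ ((n : ℝ) ^ β) ^ ((3 : ℝ) / 2) :=
        Real.rpow_le_rpow (Nat.cast_nonneg _) hβ (by norm_num)

end Thm44

end Literature.Computability.AlgebraicComplexity

end
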